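import Summits.ABC.IUTFork.LDHGenuineTowerArithPinnedP
import Literature.IUT.LogVolume.GenuineRamificationBoundsEmod
import HarnessLib

/-!
# The fork at [IUTchIII] Corollary 3.12, L-DH level: the tower-arithmetic junction WITH PRINT'S `e_mod` — the hull estimate
# with `B^e_III(P, l) := (l+1)/4·{(1 + 12·d_mod/l)·(log 𝔡 + log 𝔣) + 2·log l + 52 + (20/3)·log(e*_mod·l)·π(e*_mod·l)}`

Record-only, proof-only file (D-0012) of the abc-iut cell (campaign-S seat abc-iut-S3); TAKES NO SIDE on [IUTchIII] Cor. 3.12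
or on the reading (U)/(P) of `−|log(Θ)|`. Mochizuki, *Inter-universal Teichmüller theory IV* (RIMS manuscript Apr. 2020 =
PRIMS **57** (2021)), Thm. 1.10 p. 22 (`e_mod`, `e*_mod := 2^12·3^3·5·e_mod ≤ d*_mod`), proof Steps (ii) p. 24, (iii) pp. 25–26
("`log(𝔰^≤) ≤ … π(e*_mod·l)`", (R4) "`p_v ≤ e*_mod·l`"), (v) pp. 27–29 (`ι_{v_ℚ}`, `l*_mod = log(e*_mod·l)`).

abc-iut-S3's `LDHGenuineTowerArithPinned(P)` assembled the volume side of the crux `ThetaPartII` with the ADMISSIBLE WEAKENING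
`e_mod := d_mod` (constant `B_III(P,l)`, prime-counting term at `d*_mod·l`) — all that [IUTchIV] Cor. 2.2 consumes. THIS FILE
re-assembles it with print's `e_mod` itself, for EVERY natural number `e` with `1 ≤ e ≤ d_mod` bounding the ramification indices
over `ℚ` of the finite places of `F_mod = ℚ(j(λ))` (print's `e_mod` is the least such `e`; no new definition is introduced):

* `PointDict.deltaK_le_BIIIe` — the Step (iii)/(v) arithmetic with the prime-counting term kept at `e*·l`
  (abc-iut-S3 `Cor22.stepiii_final_of_le21` for the `(log 𝔡 + log 𝔣)`-part);
* `PointDict.deltaExplicitE_le_BIIIe` — the explicit Step (v) constant of a datum at `N := e*·l` is `≤ B^e_III(P,l)`, NO hypothesis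
  beyond `P ∈ UP`, `l ≥ 7`, `1 ≤ e ≤ d_mod`;
* `PointDict.hullEstimateOf_BIIIe_pinned` — reading (U): `T.HullEstimateOf (B^e_III P l)` modulo slot-constancy only, the (R4)
  e-term being abc-iut-S3's `ThetaVolumeDatumAt.R4_towerFact_emod` (abc-iut-S1's argument with `6·e_mod` in the middle layer);
* `PointDict.hullEstimatePerImageOf_BIIIe_pinned` / `hullVolumePerImageAtDatum_BIIIe` — reading (P): the per-image estimate with
  `B^e_III`, NO hypothesis beyond admissibility of `e` (abc-iut-S7's `DHData.hullEstimatePerImageOf_ofInput_explicit`).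
Since `e* ≤ d*`, `B^e_III ≤ B_III`: these are SHARPER than the `d_mod`-forms and feed [IUTchIV] Thm. 1.10's display with print's
constant `20·(e*_mod·l + η_prm)` verbatim (Summits-side sequel `IUTThetaPilotThm110DisplayVerbatim`).
[cite: Mochizuki2012, IUTchIV Thm. 1.10 proof Steps (ii)–(v) p. 24–29] [claim: Mochizuki2012, status: disputed] for every IUT
quotation. Nothing here asserts slot-constancy, Cor. 3.12 or a reading of it for any point.
-/

noncomputable section

namespace Summit.ABC.IUTFork

open Literature.IUT.HodgeTheaters Literature.IUT.LogVolume NumberField IsDedekindDomain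
open Literature.NumberTheory.DiophantineGeometry.GenEll
open scoped Nat.Prime

namespace PointDict

variable {P : NFPoint} {l : ℕ}

/-- `log((2^12·3^3·5·e)·l) ≥ 0` for `e, l ≥ 1`. [cite: Mochizuki2012, IUTchIV Thm. 1.10 p. 22] -/
private theorem log_estar_mul_nonneg {e l : ℕ} (he : 1 ≤ e) (hl : 1 ≤ l) :
    0 ≤ Real.log (((2 ^ 12 * 3 ^ 3 * 5 * e : ℕ) : ℝ) * l) := by
  apply Real.log_nonneg
  have h1 : (1 : ℝ) ≤ ((2 ^ 12 * 3 ^ 3 * 5 * e : ℕ) : ℝ) := by exact_mod_cast (by nlinarith : 1 ≤ 2 ^ 12 * 3 ^ 3 * 5 * e)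
  have h2 : (1 : ℝ) ≤ (l : ℝ) := by exact_mod_cast hl
  nlinarith

/-- **Step (iii)'s FINAL display + Step (v)'s prime-counting term, with the term kept at `e*_mod·l`** ([IUTchIV] Thm. 1.10,
p. 26 and p. 29): from `dK ≤ L + 2·log l + 21`, `sQ ≤ 2·d_mod·L + log(30·l)`, `sLe ≤ π(e*·l)` conclude
`(l+1)/4·{(1+4/l)·dK + (4/l)·sQ + (20/3)·log(e*·l)·sLe} ≤ B^e_III(P,l)` (`L = log-diff + log 𝔣`). abc-iut-S3's
`stepiii_final_of_le21` for the first two summands; monotonicity in `sLe` (`log(e*·l) ≥ 0`) for the third.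
[cite: Mochizuki2012, IUTchIV Thm. 1.10 proof Steps (iii), (v) p. 26–29] -/
theorem deltaK_le_BIIIe (hl : l.Prime) (h5 : 5 ≤ l) {e : ℕ} (he : 1 ≤ e) {dK sQ sLe : ℝ}
    (hK : dK ≤ P.logDiff + Cor22.logCondAvoid P {2, l} + 2 * Real.log l + 21)
    (hsQle : sQ ≤ 2 * (Cor22.dmod P : ℝ) * (P.logDiff + Cor22.logCondAvoid P {2, l}) + Real.log (2 * 3 * 5 * (l : ℝ)))
    (hsLele : sLe ≤ (π (2 ^ 12 * 3 ^ 3 * 5 * e * l) : ℝ)) :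
    ((l : ℝ) + 1) / 4 * ((1 + 4 / (l : ℝ)) * dK + 4 / (l : ℝ) * sQ
        + 20 / 3 * Real.log (((2 ^ 12 * 3 ^ 3 * 5 * e : ℕ) : ℝ) * l) * sLe) ≤
      ((l : ℝ) + 1) / 4 * ((1 + 12 * (Cor22.dmod P : ℝ) / l) * (P.logDiff + Cor22.logCondAvoid P {2, l}) + 2 * Real.log l + 52
        + 20 / 3 * Real.log (((2 ^ 12 * 3 ^ 3 * 5 * e : ℕ) : ℝ) * (l : ℝ))
          * (Nat.primeCounting (2 ^ 12 * 3 ^ 3 * 5 * e * l) : ℝ)) := by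
  have hl5 : (5 : ℝ) ≤ l := by exact_mod_cast h5
  have hl1 : 1 ≤ l := hl.one_lt.le
  have hd : (1 : ℝ) ≤ Cor22.dmod P := by exact_mod_cast Cor22.dmod_pos P
  have hL : 0 ≤ P.logDiff + Cor22.logCondAvoid P {2, l} := add_nonneg P.logDiff_nonneg (Cor22.logCondAvoid_nonneg P _)
  have h1 := Cor22.stepiii_final_of_le21 hl5 hd hL hK hsQle
  have hlog : 0 ≤ Real.log (((2 ^ 12 * 3 ^ 3 * 5 * e : ℕ) : ℝ) * l) := log_estar_mul_nonneg he hl1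
  have h2 : Real.log (((2 ^ 12 * 3 ^ 3 * 5 * e : ℕ) : ℝ) * l) * sLe ≤
      Real.log (((2 ^ 12 * 3 ^ 3 * 5 * e : ℕ) : ℝ) * l) * (Nat.primeCounting (2 ^ 12 * 3 ^ 3 * 5 * e * l) : ℝ) :=
    mul_le_mul_of_nonneg_left hsLele hlog
  have hl0 : (0 : ℝ) ≤ ((l : ℝ) + 1) / 4 := by positivity
  have h3 : (1 + 4 / (l : ℝ)) * dK + 4 / (l : ℝ) * sQ
      + 20 / 3 * Real.log (((2 ^ 12 * 3 ^ 3 * 5 * e : ℕ) : ℝ) * l) * sLe ≤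
      (1 + 12 * (Cor22.dmod P : ℝ) / l) * (P.logDiff + Cor22.logCondAvoid P {2, l}) + 2 * Real.log l + 52
        + 20 / 3 * Real.log (((2 ^ 12 * 3 ^ 3 * 5 * e : ℕ) : ℝ) * (l : ℝ))
          * (Nat.primeCounting (2 ^ 12 * 3 ^ 3 * 5 * e * l) : ℝ) := by
    have h20 := mul_le_mul_of_nonneg_left h2 (show (0 : ℝ) ≤ 20 / 3 by norm_num)
    linarith
  exact mul_le_mul_of_nonneg_left h3 hl0

/-- **S-b AT THE DATUM with print's `e_mod` (classical tower facts discharged; NO hypothesis beyond `P ∈ UP`, `l ≥ 7`,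
`1 ≤ e`).** For a genuine Θ-volume datum `T` at `(P, l)` of reading v3: the explicit Step (v) constant at threshold
`N := e*·l` (the common currency of abc-iut-c312-d1 (U) / abc-iut-S7 (P) at that `N`) is `≤ B^e_III(P, l)`.
`A(T) ≤ log-diff + log 𝔣 + 2·log l + 21` (abc-iut-S1 `sum_dite_localDegree_mul_differentOrd_le_ndeg`, abc-iut-S-d1
`ThetaVolumeDatumAt.ndeg_differentDivisor_le`), `B(T) = Σ_{p∈T(I)} log p ≤ 2·d_mod·(log-diff + log 𝔣) + log(30·l)` (abc-iut-S3
`sum_log_supportPrimes_le_pinned`), `C(T) = #{p ∈ T(I) : p ≤ e*·l} ≤ π(e*·l)`; then `deltaK_le_BIIIe`.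
[cite: Mochizuki2012, IUTchIV Thm. 1.10 proof Steps (ii)–(v) p. 24–29] [claim: Mochizuki2012, status: disputed] -/
theorem deltaExplicitE_le_BIIIe (T : Cor22.ThetaVolumeDatumAt P l) (hP : P ∈ UP) (h7 : 7 ≤ l) {e : ℕ} (he : 1 ≤ e) :
    (letI := T.instFieldF; letI := T.instNumberFieldF; letI := T.instAlgebraF; letI := T.instFieldK
     letI := T.instNumberFieldK; letI := T.instAlgebraK; letI := T.instIsElliptic
     ((l : ℝ) + 1) / 4 * ((1 + 4 / (l : ℝ)) *
          (∑ p ∈ T.I.supportPrimes, if hp : p.Prime then haveI : Fact p.Prime := ⟨hp⟩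
            (∑ v : placesOver (fieldOfModuli T.E) p, (localDegree (fieldOfModuli T.E) v.1 : ℝ) *
              differentOrd p ((T.I.σ.localFieldFamily p hp).k v)) / Module.finrank ℚ (fieldOfModuli T.E) * Real.log p
            else 0)
        + 4 / (l : ℝ) * (∑ p ∈ T.I.supportPrimes, Real.log p)
        + 20 / 3 * Real.log (((2 ^ 12 * 3 ^ 3 * 5 * e : ℕ) : ℝ) * l)
          * ((T.I.supportPrimes.filter (· ≤ 2 ^ 12 * 3 ^ 3 * 5 * e * l)).card : ℝ))) ≤
      ((l : ℝ) + 1) / 4 * ((1 + 12 * (Cor22.dmod P : ℝ) / l) * (P.logDiff + Cor22.logCondAvoid P {2, l})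
        + 2 * Real.log l + 52 + 20 / 3 * Real.log (((2 ^ 12 * 3 ^ 3 * 5 * e : ℕ) : ℝ) * (l : ℝ))
          * (Nat.primeCounting (2 ^ 12 * 3 ^ 3 * 5 * e * l) : ℝ)) := by
  classical
  letI := T.instFieldF; letI := T.instNumberFieldF; letI := T.instAlgebraF; letI := T.instFieldK
  letI := T.instNumberFieldK; letI := T.instAlgebraK; letI := T.instFieldFbar; letI := T.instAlgebraFbar
  letI := T.instAlgebraKFbar; letI := T.instIsElliptic
  have hU : P.InU := hP.1
  have hl : l.Prime := T.D.l_prime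
  have h5 : 5 ≤ l := by omega
  haveI : IsGalois (fieldOfModuli T.E) T.K := T.isGalois_fieldOfModuli_K
  have hprimes : ∀ p ∈ T.I.supportPrimes, p.Prime := fun p hp => T.I.prime_of_mem_supportPrimes hp
  -- `A ≤ log 𝔡^K ≤ log-diff + log 𝔣 + 2·log l + 21`
  have hA1 := sum_dite_localDegree_mul_differentOrd_le_ndeg (fieldOfModuli T.E) T.K T.I.σ T.I.supportPrimes hprimes
  have hA2 := T.ndeg_differentDivisor_le hU h7
  have hA : (∑ p ∈ T.I.supportPrimes, if hp : p.Prime then haveI : Fact p.Prime := ⟨hp⟩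
        (∑ v : placesOver (fieldOfModuli T.E) p, (localDegree (fieldOfModuli T.E) v.1 : ℝ) *
          differentOrd p ((T.I.σ.localFieldFamily p hp).k v)) / Module.finrank ℚ (fieldOfModuli T.E) * Real.log p
        else 0) ≤ P.logDiff + Cor22.logCondAvoid P {2, l} + 2 * Real.log l + 21 := hA1.trans hA2
  -- `B ≤ 2·d_mod·(log-diff + log 𝔣) + log(30·l)`
  have hB := T.sum_log_supportPrimes_le_pinned hP
  -- `C ≤ π(e*·l)`
  have hC : (((T.I.supportPrimes.filter (· ≤ 2 ^ 12 * 3 ^ 3 * 5 * e * l)).card : ℕ) : ℝ) ≤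
      (π (2 ^ 12 * 3 ^ 3 * 5 * e * l) : ℝ) := by
    exact_mod_cast Cor22.card_filter_le_primeCounting T.I.supportPrimes hprimes _
  exact deltaK_le_BIIIe (P := P) hl h5 he hA hB hC

/-- **S-b AT THE DATUM with print's `e_mod`, reading (U): `T.HullEstimateOf (B^e_III P l)` modulo slot-constancy ONLY** — the
(R4) e-term at `e*_mod·l` is abc-iut-S3's `ThetaVolumeDatumAt.R4_towerFact_emod` (for any `e ≥ 1` bounding the ramification
indices of `F_mod = ℚ(j(λ))` over `ℚ`); abc-iut-c312-d1's `hullEstimateOf_ofInput_explicit` at `N := e*·l` composed with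
`deltaExplicitE_le_BIIIe`. [cite: Mochizuki2012, IUTchIV Thm. 1.10 proof Steps (ii)–(v) p. 24–29]
[claim: Mochizuki2012, status: disputed] -/
theorem hullEstimateOf_BIIIe_pinned (T : Cor22.ThetaVolumeDatumAt P l) (hP : P ∈ UP) (h7 : 7 ≤ l) {e : ℕ} (he : 1 ≤ e)
    (hemod : ∀ w : HeightOneSpectrum (𝓞 (IntermediateField.adjoin ℚ ({Cor22.jInv P.x} : Set P.F))),
      w.asIdeal.ramificationIdx ℤ ≤ e)
    (hconst : letI := T.instFieldF; letI := T.instNumberFieldF; letI := T.instFieldK; letI := T.instNumberFieldK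
      letI := T.instAlgebraK; letI := T.instIsElliptic
      ∀ p ∈ T.I.supportPrimes, ∀ v w : placesOver (fieldOfModuli T.E) p,
        (DHData.ofInput T.I).logQloc p v = (DHData.ofInput T.I).logQloc p w) :
    T.HullEstimateOf (((l : ℝ) + 1) / 4 * ((1 + 12 * (Cor22.dmod P : ℝ) / l) * (P.logDiff + Cor22.logCondAvoid P {2, l})
      + 2 * Real.log l + 52 + 20 / 3 * Real.log (((2 ^ 12 * 3 ^ 3 * 5 * e : ℕ) : ℝ) * (l : ℝ))
        * (Nat.primeCounting (2 ^ 12 * 3 ^ 3 * 5 * e * l) : ℝ))) := by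
  classical
  letI := T.instFieldF; letI := T.instNumberFieldF; letI := T.instAlgebraF; letI := T.instFieldK
  letI := T.instNumberFieldK; letI := T.instAlgebraK; letI := T.instFieldFbar; letI := T.instAlgebraFbar
  letI := T.instAlgebraKFbar; letI := T.instIsElliptic
  have hl1 : 1 ≤ l := by omega
  have hXl : ((T.I.X.l : ℕ) : ℝ) = (l : ℝ) := by exact_mod_cast T.isVolumeInputOf.l_eq
  have h0 := DHData.hullEstimateOf_ofInput_explicit T.I (2 ^ 12 * 3 ^ 3 * 5 * e * l)
    (log_estar_mul_nonneg he hl1) (T.R4_towerFact_emod hP he hemod) hconst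
  rw [hXl] at h0
  exact T.hullEstimateOf_mono h0 (deltaExplicitE_le_BIIIe T hP h7 he)

/-- **Reading (P) with print's `e_mod`: `T.HullEstimatePerImageOf (B^e_III P l)`, NO hypothesis beyond the admissibility of
`e`** — abc-iut-S7's `DHData.hullEstimatePerImageOf_ofInput_explicit` at `N := e*·l` with the (R4) e-term `R4_towerFact_emod`,
composed with `deltaExplicitE_le_BIIIe`. [cite: Mochizuki2012, IUTchIV Thm. 1.10 proof Steps (ii)–(v), (x) p. 24–29]
[claim: Mochizuki2012, status: disputed] -/
theorem hullEstimatePerImageOf_BIIIe_pinned (T : Cor22.ThetaVolumeDatumAt P l) (hP : P ∈ UP) (h7 : 7 ≤ l) {e : ℕ}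
    (he : 1 ≤ e)
    (hemod : ∀ w : HeightOneSpectrum (𝓞 (IntermediateField.adjoin ℚ ({Cor22.jInv P.x} : Set P.F))),
      w.asIdeal.ramificationIdx ℤ ≤ e) :
    T.HullEstimatePerImageOf (((l : ℝ) + 1) / 4 * ((1 + 12 * (Cor22.dmod P : ℝ) / l)
      * (P.logDiff + Cor22.logCondAvoid P {2, l}) + 2 * Real.log l + 52
        + 20 / 3 * Real.log (((2 ^ 12 * 3 ^ 3 * 5 * e : ℕ) : ℝ) * (l : ℝ))
          * (Nat.primeCounting (2 ^ 12 * 3 ^ 3 * 5 * e * l) : ℝ))) := by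
  classical
  letI := T.instFieldF; letI := T.instNumberFieldF; letI := T.instAlgebraF; letI := T.instFieldK
  letI := T.instNumberFieldK; letI := T.instAlgebraK; letI := T.instFieldFbar; letI := T.instAlgebraFbar
  letI := T.instAlgebraKFbar; letI := T.instIsElliptic
  have hl1 : 1 ≤ l := by omega
  have hXl : ((T.I.X.l : ℕ) : ℝ) = (l : ℝ) := by exact_mod_cast T.isVolumeInputOf.l_eq
  have h0 := DHData.hullEstimatePerImageOf_ofInput_explicit T.I (2 ^ 12 * 3 ^ 3 * 5 * e * l)
    (log_estar_mul_nonneg he hl1) (T.R4_towerFact_emod hP he hemod)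
  rw [hXl] at h0
  unfold Cor22.ThetaVolumeDatumAt.HullEstimatePerImageOf
  exact T.I.hullEstimatePerImageOf_mono h0 (deltaExplicitE_le_BIIIe T hP h7 he)

/-- **`Cor22.HullVolumePerImageAtDatum P l (B^e_III P l)` with print's `e_mod`, at every admissible `(P, l)`, `l ≥ 7` — NO
hypothesis beyond the admissibility of `e`** (the `∀ T` form, reading (P)).
[cite: Mochizuki2012, IUTchIV Thm. 1.10 proof Steps (ii)–(v), (x) p. 24–29] [claim: Mochizuki2012, status: disputed] -/
theorem hullVolumePerImageAtDatum_BIIIe (hP : P ∈ UP) (h7 : 7 ≤ l) {e : ℕ} (he : 1 ≤ e)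
    (hemod : ∀ w : HeightOneSpectrum (𝓞 (IntermediateField.adjoin ℚ ({Cor22.jInv P.x} : Set P.F))),
      w.asIdeal.ramificationIdx ℤ ≤ e) :
    Cor22.HullVolumePerImageAtDatum P l (((l : ℝ) + 1) / 4 * ((1 + 12 * (Cor22.dmod P : ℝ) / l)
      * (P.logDiff + Cor22.logCondAvoid P {2, l}) + 2 * Real.log l + 52
        + 20 / 3 * Real.log (((2 ^ 12 * 3 ^ 3 * 5 * e : ℕ) : ℝ) * (l : ℝ))
          * (Nat.primeCounting (2 ^ 12 * 3 ^ 3 * 5 * e * l) : ℝ))) :=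
  fun T => hullEstimatePerImageOf_BIIIe_pinned T hP h7 he hemod

end PointDict

end Summit.ABC.IUTFork

end
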